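import Literature.NumberTheory.NumberFields.BauerDegreeOnePrimes
import HarnessLib

/-!
# Bauer's theorem, general form, for abstract number fields `L/K` Galois and `M/K` finite
# (Neukirch, *Algebraic Number Theory*, VII (13.9)): `P(M|K) ⊆ P(L|K) ⟹ L ↪ M` over `K`

Topic `NumberTheory/NumberFields`.  Theorem-only file (no definition, no named fact, D-0026),
unconditional, universe-polymorphic; companion of `BauerDegreeOnePrimes.lean` (abc-iut GAP
`G-L4d2g4-1-NU-DEDUCTION`, sub-DAG `plan/L4/SUBDAG-NeukirchUchida.md` row R5 BAUER, the
"abstract number fields" spelling: conclusion `Nonempty (L →ₐ[K] M)`, and `L ≃ₐ[K] M` when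
`[L:K] = [M:K]`); classical, outside the [IUTchIII] Cor. 3.12 cone; no side taken there.

> Neukirch VII (13.9) (M. Bauer): "If `L|K` is Galois and `M|K` is an arbitrary finite extension,
> then `P(L|K) ⊇ P(M|K) ⟺ L ⊆ M`" (`P(M|K)` = the unramified primes of `K` with a prime divisor
> of degree `1` in `M`, p. 547; inclusions up to finitely many primes).

* `fieldRange_le_fieldRange_of_forall_exists_degOne_imp_mem_splitPrimes` — for `K`-embeddings
  `eL : L → K̄`, `eM : M → K̄` of number fields, `L/K` Galois: if all but finitely many primes `v`
  of `K` having a prime of `𝓞 M` above them with `e = f = 1` split completely in `L`, then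
  `eL(L) ⊆ eM(M)` (the tree's tower form `le_fieldRange_of_forall_exists_degOne_imp_mem_splitPrimes`
  in the finite Galois extension `normalClosure K (eL(L) eM(M)) K̄`, `M → K̄` factored through it);
* `nonempty_algHom_of_forall_exists_degOne_imp_mem_splitPrimes` — hence a `K`-embedding `L → M`;
* `nonempty_algEquiv_of_forall_exists_degOne_imp_mem_splitPrimes` — and `L ≃ₐ[K] M` if moreover
  `[L:K] = [M:K]` (Neukirch VII (13.10): a Galois extension is determined by `P(L|K)`).

Prior tree statements (not restated): base `ℚ`, hypothesis through degree-one PLACES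
(`∃ w, N w = p`) and `SplitsCompletely L₁ p`, fields in `Type` —
`nonempty_algHom_of_degreeOne_splitsCompletely` (`BauerDegreeOnePlaces.lean`, [NSW] 12.2.5 as
cited by [FrdI] Thm. 6.4 (iv)); Galois–Galois case — `le_of_splitPrimes_subset`
(`BauerSplitPrimes.lean`).  The present file is the general base `K`, `Type*`, `e = f = 1` /
`splitPrimes` spelling of sub-DAG row R5.

## References

* J. Neukirch, *Algebraic Number Theory*, Grundlehren 322, Springer 1999, Ch. VII §13, p. 547,
  Prop. (13.9) (M. Bauer) and its proof (p. 548), Cor. (13.10). [NeukirchANT1999]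
* J. Neukirch, A. Schmidt, K. Wingberg, *Cohomology of Number Fields*, 2nd ed. (2008), XII §2
  (use in the Neukirch–Uchida theorem). [NeukirchSchmidtWingberg2008]
-/

noncomputable section

open NumberField IsDedekindDomain Filter

namespace Literature.NumberTheory.NumberFields

open Literature.NumberTheory.GaloisRepresentations

variable {K : Type*} [Field K] [NumberField K]
variable {L M : Type*} [Field L] [NumberField L] [Algebra K L] [Field M] [NumberField M]
  [Algebra K M]

/-- **Bauer's theorem, general form, for embedded number fields** (Neukirch VII (13.9)).  Let
`eL : L → K̄` and `eM : M → K̄` be `K`-embeddings of number fields into `K̄ = AlgebraicClosure K`,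
`L/K` Galois.  If for all but finitely many primes `v` of `K` the existence of a prime `P` of
`𝓞 M` above `v` with `e(P|v) = f(P|v) = 1` implies that `v` splits completely in `L`, then
`eL(L) ⊆ eM(M)`.  Proof: the tree's tower form
`le_fieldRange_of_forall_exists_degOne_imp_mem_splitPrimes` in the finite Galois extension
`N₀ = normalClosure K (eL(L) eM(M)) K̄` of `K`, for the tower `K → M → N₀` (through `eM`) and the
Galois intermediate field `eL(L) ⊆ N₀` (`splitPrimes` is invariant under `L ≃ₐ[K] eL(L)`,
`splitPrimes_congr`). [cite: NeukirchANT1999, Ch. VII Prop. (13.9) (proof, p. 548)] -/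
theorem fieldRange_le_fieldRange_of_forall_exists_degOne_imp_mem_splitPrimes [IsGalois K L]
    (eL : L →ₐ[K] AlgebraicClosure K) (eM : M →ₐ[K] AlgebraicClosure K)
    (h : ∀ᶠ v : HeightOneSpectrum (𝓞 K) in cofinite,
      (∃ P ∈ v.asIdeal.primesOver (𝓞 M),
          P.ramificationIdx (𝓞 K) = 1 ∧ P.inertiaDeg (𝓞 K) = 1) → v ∈ splitPrimes K L) :
    eL.fieldRange ≤ eM.fieldRange := by
  classical
  set L₁ : IntermediateField K (AlgebraicClosure K) := eL.fieldRange with hL₁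
  set M₁ : IntermediateField K (AlgebraicClosure K) := eM.fieldRange with hM₁
  set εL : L ≃ₐ[K] L₁ := (show L ≃ₐ[K] eL.fieldRange from AlgEquiv.ofInjectiveField eL)
    with hεL
  set εM : M ≃ₐ[K] M₁ := (show M ≃ₐ[K] eM.fieldRange from AlgEquiv.ofInjectiveField eM)
    with hεM
  haveI : FiniteDimensional K L₁ := LinearEquiv.finiteDimensional εL.toLinearEquiv
  haveI : FiniteDimensional K M₁ := LinearEquiv.finiteDimensional εM.toLinearEquiv
  -- a finite Galois extension `N₀ ⊇ eL(L), eM(M)` of `K` inside `K̄`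
  haveI : FiniteDimensional K (L₁ ⊔ M₁ : IntermediateField K (AlgebraicClosure K)) :=
    IntermediateField.finiteDimensional_sup L₁ M₁
  set N₀ : IntermediateField K (AlgebraicClosure K) :=
    IntermediateField.normalClosure K (L₁ ⊔ M₁ : IntermediateField K (AlgebraicClosure K))
      (AlgebraicClosure K) with hN₀
  haveI : IsGalois K N₀ := isGalois_iff.mpr ⟨inferInstance, inferInstance⟩
  haveI : NumberField N₀ := NumberField.of_module_finite K N₀
  have hLM : L₁ ⊔ M₁ ≤ N₀ := IntermediateField.le_normalClosure _
  have hL : L₁ ≤ N₀ := le_sup_left.trans hLM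
  have hM : M₁ ≤ N₀ := le_sup_right.trans hLM
  -- the tower `K → M → N₀` through `eM`
  set ιM : M →ₐ[K] N₀ := (IntermediateField.inclusion hM).comp (εM : M →ₐ[K] M₁) with hιM
  letI : Algebra M N₀ := ιM.toRingHom.toAlgebra
  haveI : IsScalarTower K M N₀ := IsScalarTower.of_algebraMap_eq fun x => (ιM.commutes x).symm
  -- `eL(L)` as an intermediate field of `N₀ / K`
  set L' : IntermediateField K N₀ := IntermediateField.restrict hL with hL'
  haveI : IsGalois K L' :=
    IsGalois.of_algEquiv (εL.trans (IntermediateField.restrict_algEquiv hL))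
  haveI : NumberField L' := NumberField.of_module_finite K L'
  have h' : ∀ᶠ v : HeightOneSpectrum (𝓞 K) in cofinite,
      (∃ P ∈ v.asIdeal.primesOver (𝓞 M),
          P.ramificationIdx (𝓞 K) = 1 ∧ P.inertiaDeg (𝓞 K) = 1) → v ∈ splitPrimes K L' := by
    rw [← splitPrimes_congr (εL.trans (IntermediateField.restrict_algEquiv hL))]
    exact h
  have hcore := le_fieldRange_of_forall_exists_degOne_imp_mem_splitPrimes (M := M) L' h'
  intro y hy
  have hy' : (⟨y, hL hy⟩ : N₀) ∈ L' := (IntermediateField.mem_restrict hL _).mpr hy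
  obtain ⟨m, hm⟩ := AlgHom.mem_fieldRange.mp (hcore hy')
  have hmy : ((ιM m : N₀) : AlgebraicClosure K) = y :=
    congrArg (fun z : N₀ => (z : AlgebraicClosure K)) hm
  exact AlgHom.mem_fieldRange.mpr ⟨m, hmy⟩

/-- **Bauer's theorem, general form, for abstract number fields** (Neukirch VII (13.9)): `L/K`
finite Galois, `M/K` finite; if all but finitely many primes `v` of `K` having a prime of `𝓞 M`
above them with `e = f = 1` split completely in `L`, then there is a `K`-embedding `L → M`
(embed both into `K̄` and apply
`fieldRange_le_fieldRange_of_forall_exists_degOne_imp_mem_splitPrimes`).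
[cite: NeukirchANT1999, Ch. VII Prop. (13.9)] -/
theorem nonempty_algHom_of_forall_exists_degOne_imp_mem_splitPrimes [IsGalois K L]
    (h : ∀ᶠ v : HeightOneSpectrum (𝓞 K) in cofinite,
      (∃ P ∈ v.asIdeal.primesOver (𝓞 M),
          P.ramificationIdx (𝓞 K) = 1 ∧ P.inertiaDeg (𝓞 K) = 1) → v ∈ splitPrimes K L) :
    Nonempty (L →ₐ[K] M) := by
  classical
  set eL : L →ₐ[K] AlgebraicClosure K := IsAlgClosed.lift with heL
  set eM : M →ₐ[K] AlgebraicClosure K := IsAlgClosed.lift with heM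
  have hle := fieldRange_le_fieldRange_of_forall_exists_degOne_imp_mem_splitPrimes eL eM h
  set εL : L ≃ₐ[K] eL.fieldRange :=
    (show L ≃ₐ[K] eL.fieldRange from AlgEquiv.ofInjectiveField eL) with hεL
  set εM : M ≃ₐ[K] eM.fieldRange :=
    (show M ≃ₐ[K] eM.fieldRange from AlgEquiv.ofInjectiveField eM) with hεM
  exact ⟨(εM.symm : eM.fieldRange →ₐ[K] M).comp
    ((IntermediateField.inclusion hle).comp (εL : L →ₐ[K] eL.fieldRange))⟩

/-- **Bauer's theorem, equality form for abstract number fields** (Neukirch VII (13.9)–(13.10)):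
with the hypotheses of `nonempty_algHom_of_forall_exists_degOne_imp_mem_splitPrimes`, if moreover
`[L : K] = [M : K]` then `L ≃ₐ[K] M`. [cite: NeukirchANT1999, Ch. VII Prop. (13.9) and Cor. (13.10)] -/
theorem nonempty_algEquiv_of_forall_exists_degOne_imp_mem_splitPrimes [IsGalois K L]
    (h : ∀ᶠ v : HeightOneSpectrum (𝓞 K) in cofinite,
      (∃ P ∈ v.asIdeal.primesOver (𝓞 M),
          P.ramificationIdx (𝓞 K) = 1 ∧ P.inertiaDeg (𝓞 K) = 1) → v ∈ splitPrimes K L)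
    (hdeg : Module.finrank K L = Module.finrank K M) :
    Nonempty (L ≃ₐ[K] M) := by
  obtain ⟨φ⟩ := nonempty_algHom_of_forall_exists_degOne_imp_mem_splitPrimes (L := L) (M := M) h
  have hinj : Function.Injective φ.toLinearMap := φ.toRingHom.injective
  have hsurj : Function.Surjective φ.toLinearMap :=
    (LinearMap.injective_iff_surjective_of_finrank_eq_finrank hdeg).mp hinj
  exact ⟨AlgEquiv.ofBijective φ ⟨φ.toRingHom.injective, fun y => hsurj y⟩⟩

end Literature.NumberTheory.NumberFields

end
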